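import Summits.Ventures.PercRepro.RankLevelSetRuleQThirteenCert
import Summits.Ventures.PercRepro.RankLevelSetRuleQThirteenCore
import Summits.Ventures.PercRepro.RankLevelSetRuleQConvTwentyThreeBound
import Summits.Ventures.PercRepro.RankLevelSetRuleQConvTwentyOneBound

/-!
# PercRepro — THE FAMILY `k = 13` ON ITS WHOLE UNTRUNCATED REGIME, FOR EVERY `q` (p4, gen 25; C-044; paper
proofs/P4-CELL-THREE.md §13.5, §13.7)

**`rhat_thirteen_whole (q m : ℕ) (hm : m + 12 ≤ q) : phiK (q + 13) q ≤ rhat q 13 m`** — Rule Q's equal split pays `Φ(q+13, q)` to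
EVERY member of EVERY cell `(q+13, q)` with `#P ≤ q − 12` (the whole untruncated regime `u = q − #P ≥ k − 1`), uniformly in `q`.
The same proof as RankLevelSetRuleQFiveWhole (paper §13): `(R̂ − Φ)·den = na·S(q,m) + nb` (**`rhat_thirteen_key`**) with the master
sum `S` of RankLevelSetRuleQSumS, the two-sided continued-fraction bounds `C_23 ≤ S ≤ C_21` (`C_23` resp. `C_21` from the
tree or proved as a sub- or super-solution of the recurrence), and the two certificates `na·C_23 + nb ≥ 0`,
`na·C_21 + nb ≥ 0` (polynomials with non-negative coefficients in `(q−m−12, m)`).  No `sorry`; axioms standard.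
-/

namespace PercRepro

open Finset

/-- The lower certificate is non-negative for `a, b ≥ 0`. -/
lemma thirteen_lower_cert_nonneg (a b : ℚ) (ha : 0 ≤ a) (hb : 0 ≤ b) :
    0 ≤ naThirteen (a + b + 12) b * cfTwentyThreeN (a + b + 12) b + nbThirteen (a + b + 12) b * cfTwentyThreeD (a + b + 12) b := by
  rw [thirteen_lower_cert]; exact (add_nonneg (add_nonneg (add_nonneg (add_nonneg (add_nonneg (add_nonneg (thirteenLowerCert1_nonneg a b ha hb) (thirteenLowerCert2_nonneg a b ha hb)) (thirteenLowerCert3_nonneg a b ha hb)) (thirteenLowerCert4_nonneg a b ha hb)) (thirteenLowerCert5_nonneg a b ha hb)) (thirteenLowerCert6_nonneg a b ha hb)) (thirteenLowerCert7_nonneg a b ha hb))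

/-- The upper certificate is non-negative for `a, b ≥ 0`. -/
lemma thirteen_upper_cert_nonneg (a b : ℚ) (ha : 0 ≤ a) (hb : 0 ≤ b) :
    0 ≤ naThirteen (a + b + 12) b * cfTwentyOneN (a + b + 12) b + nbThirteen (a + b + 12) b * cfTwentyOneD (a + b + 12) b := by
  rw [thirteen_upper_cert]; exact (add_nonneg (add_nonneg (add_nonneg (add_nonneg (add_nonneg (add_nonneg (thirteenUpperCert1_nonneg a b ha hb) (thirteenUpperCert2_nonneg a b ha hb)) (thirteenUpperCert3_nonneg a b ha hb)) (thirteenUpperCert4_nonneg a b ha hb)) (thirteenUpperCert5_nonneg a b ha hb)) (thirteenUpperCert6_nonneg a b ha hb)) (thirteenUpperCert7_nonneg a b ha hb))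

/-- `na·C_23 + nb ≥ 0` on the untruncated regime. -/
lemma thirteen_lower_nonneg (q m : ℕ) (hm : m + 12 ≤ q) :
    0 ≤ naThirteen q m * (cfTwentyThreeN q m / cfTwentyThreeD q m) + nbThirteen q m := by
  have hD := cfTwentyThreeD_pos q m (by positivity) (by exact_mod_cast (show m + 1 ≤ q by omega))
  have ha : (0 : ℚ) ≤ (q : ℚ) - m - 12 := by
    have : ((m + 12 : ℕ) : ℚ) ≤ q := by exact_mod_cast hm
    push_cast at this; linarith
  have key := thirteen_lower_cert_nonneg ((q : ℚ) - m - 12) m ha (by positivity)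
  rw [show (q : ℚ) - m - 12 + m + 12 = q by ring] at key
  have e : naThirteen q m * (cfTwentyThreeN q m / cfTwentyThreeD q m) + nbThirteen q m
      = (naThirteen q m * cfTwentyThreeN q m + nbThirteen q m * cfTwentyThreeD q m) / cfTwentyThreeD q m := by
    rw [eq_div_iff hD.ne']; ring_nf; field_simp
  rw [e]
  exact div_nonneg key hD.le

/-- `na·C_21 + nb ≥ 0` on the untruncated regime. -/
lemma thirteen_upper_nonneg (q m : ℕ) (hm : m + 12 ≤ q) :
    0 ≤ naThirteen q m * (cfTwentyOneN q m / cfTwentyOneD q m) + nbThirteen q m := by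
  have hD := cfTwentyOneD_pos q m (by positivity) (by exact_mod_cast (show m + 1 ≤ q by omega))
  have ha : (0 : ℚ) ≤ (q : ℚ) - m - 12 := by
    have : ((m + 12 : ℕ) : ℚ) ≤ q := by exact_mod_cast hm
    push_cast at this; linarith
  have key := thirteen_upper_cert_nonneg ((q : ℚ) - m - 12) m ha (by positivity)
  rw [show (q : ℚ) - m - 12 + m + 12 = q by ring] at key
  have e : naThirteen q m * (cfTwentyOneN q m / cfTwentyOneD q m) + nbThirteen q m
      = (naThirteen q m * cfTwentyOneN q m + nbThirteen q m * cfTwentyOneD q m) / cfTwentyOneD q m := by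
    rw [eq_div_iff hD.ne']; ring_nf; field_simp
  rw [e]
  exact div_nonneg key hD.le

/-- **THE FAMILY `k = 13` ON ITS WHOLE UNTRUNCATED REGIME, FOR EVERY `q`**: `Φ(q+13, q) ≤ R̂(q, 13, m)` for every `m ≤ q − 12`. -/
theorem rhat_thirteen_whole (q m : ℕ) (hm : m + 12 ≤ q) : phiK (q + 13) q ≤ rhat q 13 m := by
  have hkey := rhat_thirteen_key q m hm
  have hden := denThirteen_pos q m
  have hlo := cfTwentyThree_le_sumS q m (by omega)
  have hhi := sumS_le_cfTwentyOne q m (by omega)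
  have hL := thirteen_lower_nonneg q m hm
  have hU := thirteen_upper_nonneg q m hm
  have hmain : 0 ≤ naThirteen q m * sumS q m + nbThirteen q m := by
    rcases le_total 0 (naThirteen q m) with hA | hA
    · calc (0 : ℚ) ≤ naThirteen q m * (cfTwentyThreeN q m / cfTwentyThreeD q m) + nbThirteen q m := hL
        _ ≤ naThirteen q m * sumS q m + nbThirteen q m := by
          gcongr
    · calc (0 : ℚ) ≤ naThirteen q m * (cfTwentyOneN q m / cfTwentyOneD q m) + nbThirteen q m := hU
        _ ≤ naThirteen q m * sumS q m + nbThirteen q m := by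
          have := mul_le_mul_of_nonpos_left hhi hA
          linarith
  rw [← sub_nonneg]
  rw [← hkey] at hmain
  exact nonneg_of_mul_nonneg_left hmain hden

/-- The matroid form: Rule Q's equal split pays `Φ(q+13,q)` to every member of every cell `(q+13, q)` with `#P ≤ q − 12`
(the whole untruncated regime of the family `k = 13`), for every `q`. -/
theorem ruleQRecv_ge_thirteen_whole (q m : ℕ) (hm : m + 12 ≤ q) : phiK (q + 13) q ≤ rhat q 13 m :=
  rhat_thirteen_whole q m hm

end PercRepro
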